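import Summits.QuantumAdvantage.QuantumAdvantage.Theorems.SparsityDialMP5

/-!
# SparsityDial — part MP6 of 10 of the «MovingPointers» package (decomp-qadv lens 2, g18): §C1–§C2 prefix stretch for Σα ≠ 0; line identity; parity lemma `exists_shift_even`

Imports its predecessor `SparsityDialMP5` (linear chain MP1 → … → MP10); the package overview is the module docstring of `SparsityDialMP1`.
No `sorry`; standard axioms; no instances / notation.
-/

set_option linter.unusedVariables false
set_option linter.dupNamespace false

noncomputable section
open scoped Classical

namespace Summit.QuantumAdvantage.QuantumAdvantage.Theorems.SparsityDial

open Finset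
open Literature.Computability.QuantumComplexity Literature.Computability.QuantumComplexity.RingHLF
open Literature.Computability.MetaComplexity Literature.Computability.MetaComplexity.Smolensky
open Summit.QuantumAdvantage.AdviceFreeQNC0
open Summit.QuantumAdvantage.QuantumAdvantage.Theorems.HolonomyDial (gCond)
open Summit.QuantumAdvantage.QuantumAdvantage.Theorems.LocusDial
open Summit.QuantumAdvantage.QuantumAdvantage.Theorems.AnchorDial (dev outB win_iff card_odd_ge)
open Summit.QuantumAdvantage.QuantumAdvantage.Theorems.HolonomyDial (card_odd_le)
open Summit.QuantumAdvantage.QuantumAdvantage.Theorems.StabilizerDial (eventually_polylog StabFew stabFew_of_fewLocus)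

/-! ## §C1  REV 5 «AnyPointers»: the PREFIX stretch suffices for every twist with `Σ α ≠ 0` -/

section AnyPhase
variable {N t : ℕ}

/-- prefix stretch: for `Σ α ≠ 0` and all pointers `≥ 2j`, the occupation profile equals `2Σα ≠ 0` on `[0, 2j)` — no
sortedness, no gaps. -/
theorem occM_prefix {m : ℕ} (α : Fin m → ZMod 3) (hT : (∑ l : Fin m, α l) ≠ 0) (k : Fin m → ℕ) (j : ℕ)
    (h2j : ∀ l, 2 * j ≤ k l) (hkN : ∀ l, k l + 1 ≤ N) (hm : 1 ≤ m) :
    ∃ m₀ : ℕ, m₀ + 2 * j ≤ N ∧ ∀ i, m₀ ≤ i → i + 2 ≤ m₀ + 2 * j → occM N α k i ≠ 0 := by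
  have l0 : Fin m := ⟨0, by omega⟩
  refine ⟨0, ?_, ?_⟩
  · have := h2j l0; have := hkN l0; omega
  · intro i _ hi2
    have hocc : occM N α k i = 2 * ∑ l : Fin m, α l := by
      unfold occM
      rw [mul_sum]
      apply sum_congr rfl
      intro l _
      have h1 : i < k l := by have := h2j l; omega
      have h2 : i < N - 1 := by have := h2j l0; have := hkN l0; omega
      rw [if_pos h1, if_pos h2]; ring
    rw [hocc]
    intro h
    apply hT
    have key : ∀ a : ZMod 3, 2 * a = 0 → a = 0 := by decide
    exact key _ h

/-- SparsityDial «MovingPointers» helper `normSq_appSumM_le_prefix` (decomp-qadv lens-2 g18 land package; see the module docstring). -/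
theorem normSq_appSumM_le_prefix (μ' : Fin N → ZMod 3) {m : ℕ} (α : Fin m → ZMod 3) (hT : (∑ l : Fin m, α l) ≠ 0)
    (k : Fin m → ℕ) (j : ℕ) (h2j : ∀ l, 2 * j ≤ k l) (hkN : ∀ l, k l + 1 ≤ N) (hm : 1 ≤ m) :
    Complex.normSq (∑ x ∈ (univ : Finset (Fin N → Bool)).filter (fun x => OddZeros x),
      χ ((∑ i : Fin N, μ' i * (if x i then 1 else 0)) +
        ∑ l : Fin m, α l * (((Wk x (k l) : ℕ) : ZMod 3) + ((Wk x (N - 1) : ℕ) : ZMod 3)))) ≤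
      4 ^ (N - 2 * j) * 12 ^ j := by
  obtain ⟨m₀, hm₀, hc⟩ := occM_prefix (N := N) α hT k j h2j hkN hm
  have h := normSq_oddSum_le_stretch (N := N) (μA μ') (occM N α k) m₀ j hm₀ hc
  simp_rw [phaseK_appM] at h
  exact h

/-- **prefix fibre bound**: `432·3^m·3^t·‖fibSumM‖ ≤ 2^N` for every twist with `Σ α ≠ 0`, pointers `≥ 2j` ARBITRARY otherwise. -/
theorem fibSumM_bound_prefix (M : Fin t → Fin N → ZMod 3) (v : Fin t → ZMod 3) {m : ℕ} (α a : Fin m → ZMod 3)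
    (hT : (∑ l : Fin m, α l) ≠ 0) (k : Fin m → ℕ) (j : ℕ) (h2j : ∀ l, 2 * j ≤ k l) (hkN : ∀ l, k l + 1 ≤ N)
    (hm : 1 ≤ m) (hjt : 8 * (t + m + 3) + 20 ≤ j) :
    (432 : ℝ) * 3 ^ m * 3 ^ t * ‖fibSumM M v α a k‖ ≤ 2 ^ N := by
  have l0 : Fin m := ⟨0, by omega⟩
  have h2jN : 2 * j ≤ N := by have := h2j l0; have := hkN l0; omega
  have hexp := fibSumM_expand M v α a k
  set Z : (Fin t → ZMod 3) → ℂ := fun lam =>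
      ∑ x ∈ (univ : Finset (Fin N → Bool)).filter (fun x => OddZeros x),
        χ ((∑ i : Fin N, (∑ s : Fin t, lam s * M s i) * (if x i then 1 else 0)) +
          ∑ l : Fin m, α l * (((Wk x (k l) : ℕ) : ZMod 3) + ((Wk x (N - 1) : ℕ) : ZMod 3))) with hZ
  have hnorm : (3 : ℝ) ^ t * ‖fibSumM M v α a k‖ ≤ ∑ lam : Fin t → ZMod 3, ‖Z lam‖ := by
    have e3 : ‖(3 : ℂ) ^ t * fibSumM M v α a k‖ = (3 : ℝ) ^ t * ‖fibSumM M v α a k‖ := by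
      rw [norm_mul, norm_pow]
      simp
    rw [← e3, hexp]
    refine (norm_sum_le _ _).trans ?_
    apply sum_le_sum
    intro lam _
    rw [norm_mul, norm_χ, mul_one]
  have hper : ∀ lam : Fin t → ZMod 3, (16 : ℝ) * 3 ^ (t + m + 3) * ‖Z lam‖ ≤ 2 ^ N :=
    fun lam => norm_of_normSq_budget (Z lam) (t + m + 3) N j h2jN hjt
      (normSq_appSumM_le_prefix (fun i => ∑ s : Fin t, lam s * M s i) α hT k j h2j hkN hm)
  have hsum := sum_le_sum (fun lam (_ : lam ∈ (univ : Finset (Fin t → ZMod 3))) => hper lam)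
  rw [← mul_sum, sum_const, card_univ, Fintype.card_fun, ZMod.card, Fintype.card_fin, nsmul_eq_mul] at hsum
  push_cast at hsum
  have h3pos : (0 : ℝ) < 3 ^ t := by positivity
  have e27 : (3 : ℝ) ^ (t + m + 3) = 27 * 3 ^ m * 3 ^ t := by rw [pow_add, pow_add]; norm_num; ring
  rw [e27] at hsum
  have hc : (3 : ℝ) ^ t * ((432 : ℝ) * 3 ^ m * 3 ^ t * ‖fibSumM M v α a k‖) ≤ 3 ^ t * 2 ^ N := by
    have h16 : (0 : ℝ) ≤ 16 * (27 * 3 ^ m * 3 ^ t) := by positivity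
    calc (3 : ℝ) ^ t * ((432 : ℝ) * 3 ^ m * 3 ^ t * ‖fibSumM M v α a k‖)
        = 16 * (27 * 3 ^ m * 3 ^ t) * (3 ^ t * ‖fibSumM M v α a k‖) := by ring
      _ ≤ 16 * (27 * 3 ^ m * 3 ^ t) * ∑ lam : Fin t → ZMod 3, ‖Z lam‖ := mul_le_mul_of_nonneg_left hnorm h16
      _ ≤ 3 ^ t * 2 ^ N := hsum
  exact le_of_mul_le_mul_left hc h3pos

end AnyPhase

/-! ## §C2  Lines in direction `(1,…,1)`: the twists with `Σ α = 0` count the line through a cell -/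

section Lines
variable {N t : ℕ}

/-- **line identity**: `3 · Σ_{Σα = 0} fibSumM(α, a) = 3^m · Σ_γ #cell(a − γ·1)`. -/
theorem line_identity (M : Fin t → Fin N → ZMod 3) (v : Fin t → ZMod 3) {m : ℕ} (a : Fin m → ZMod 3) (k : Fin m → ℕ) :
    (3 : ℂ) * ∑ α ∈ (univ : Finset (Fin m → ZMod 3)).filter (fun α => ∑ l, α l = 0), fibSumM M v α a k =
      (3 : ℂ) ^ m * ∑ γ : ZMod 3, (((fib M v).filter (fun x => ∀ l, kph x (k l) = a l - γ)).card : ℂ) := by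
  have h1 : (3 : ℂ) * ∑ α ∈ (univ : Finset (Fin m → ZMod 3)).filter (fun α => ∑ l, α l = 0), fibSumM M v α a k =
      ∑ α : Fin m → ZMod 3, (∑ γ : ZMod 3, χ (γ * ∑ l, α l)) * fibSumM M v α a k := by
    rw [mul_sum, sum_filter]
    apply sum_congr rfl
    intro α _
    rw [sum_χ_mul]
    split_ifs <;> simp
  have h2 : ∀ α : Fin m → ZMod 3, (∑ γ : ZMod 3, χ (γ * ∑ l, α l)) * fibSumM M v α a k =
      ∑ γ : ZMod 3, ∑ x ∈ fib M v, χ (∑ l : Fin m, α l * ((kph x (k l) - a l) + γ)) := by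
    intro α
    unfold fibSumM
    rw [sum_mul]
    apply sum_congr rfl
    intro γ _
    rw [mul_sum]
    apply sum_congr rfl
    intro x _
    rw [← χ_add]
    congr 1
    rw [mul_sum, ← sum_add_distrib]
    apply sum_congr rfl
    intro l _
    ring
  have h3 : ∀ (γ : ZMod 3) (x : Fin N → Bool),
      ∑ α : Fin m → ZMod 3, χ (∑ l : Fin m, α l * ((kph x (k l) - a l) + γ)) =
        if (∀ l, kph x (k l) = a l - γ) then (3 : ℂ) ^ m else 0 := by
    intro γ x
    rw [sum_χ_lin m (fun l => (kph x (k l) - a l) + γ)]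
    by_cases h : ∀ l, kph x (k l) = a l - γ
    · rw [if_pos h, if_pos]
      funext l
      simp only [Pi.zero_apply]
      rw [h l]; ring
    · rw [if_neg h, if_neg]
      intro h0
      apply h
      intro l
      have := congrFun h0 l
      simp only [Pi.zero_apply] at this
      linear_combination this
  rw [h1, sum_congr rfl (fun α _ => h2 α), sum_comm, mul_sum]
  apply sum_congr rfl
  intro γ _
  rw [sum_comm, sum_congr rfl (fun x _ => h3 γ x), sum_ite, sum_const_zero, add_zero, sum_const, nsmul_eq_mul]
  ring

/-- **no cell escapes a losing shift**: for every phase pattern `b ∈ 𝔽₃^m` some all-ones shift `b + γ·1` has an EVEN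
number of coordinates `≠ 2` (counting mod 2: the three value classes of `b` cannot all have the parity of `m+1`). -/
theorem exists_shift_even {m : ℕ} (b : Fin m → ZMod 3) :
    ∃ γ : ZMod 3, Even ((univ : Finset (Fin m)).filter (fun l => b l + γ ≠ 2)).card := by
  by_contra hne
  push Not at hne
  have hcnt : ∀ γ : ZMod 3, ((univ : Finset (Fin m)).filter (fun l => b l + γ ≠ 2)).card +
      ((univ : Finset (Fin m)).filter (fun l => b l = 2 - γ)).card = m := by
    intro γ
    have h := Finset.card_filter_add_card_filter_not (s := (univ : Finset (Fin m))) (fun l => b l + γ ≠ 2)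
    rw [card_univ, Fintype.card_fin] at h
    have hset : (univ : Finset (Fin m)).filter (fun l => ¬ (b l + γ ≠ 2)) =
        (univ : Finset (Fin m)).filter (fun l => b l = 2 - γ) := by
      apply filter_congr
      intro l _
      push Not
      constructor
      · intro e; linear_combination e
      · intro e; linear_combination e
    rw [hset] at h
    exact h
  have hpart : ((univ : Finset (Fin m)).filter (fun l => b l = 2 - 0)).card +
      ((univ : Finset (Fin m)).filter (fun l => b l = 2 - 1)).card +
      ((univ : Finset (Fin m)).filter (fun l => b l = 2 - 2)).card = m := by
    have key : ∀ c : ZMod 3, c = 2 - 0 ∨ c = 2 - 1 ∨ c = 2 - 2 := by decide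
    have d01 : ∀ c : ZMod 3, c = 2 - 0 → ¬ c = 2 - 1 := by decide
    have d02 : ∀ c : ZMod 3, c = 2 - 0 → ¬ c = 2 - 2 := by decide
    have d12 : ∀ c : ZMod 3, c = 2 - 1 → ¬ c = 2 - 2 := by decide
    have hu : (univ : Finset (Fin m)) =
        (((univ : Finset (Fin m)).filter (fun l => b l = 2 - 0)) ∪
          ((univ : Finset (Fin m)).filter (fun l => b l = 2 - 1))) ∪
          ((univ : Finset (Fin m)).filter (fun l => b l = 2 - 2)) := by
      ext l
      simp only [mem_union, mem_filter, mem_univ, true_and, true_iff]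
      have := key (b l)
      tauto
    have hd1 : Disjoint ((univ : Finset (Fin m)).filter (fun l => b l = 2 - 0))
        ((univ : Finset (Fin m)).filter (fun l => b l = 2 - 1)) := by
      rw [disjoint_filter]; intro l _ h1; exact d01 _ h1
    have hd2 : Disjoint (((univ : Finset (Fin m)).filter (fun l => b l = 2 - 0)) ∪
        ((univ : Finset (Fin m)).filter (fun l => b l = 2 - 1)))
        ((univ : Finset (Fin m)).filter (fun l => b l = 2 - 2)) := by
      rw [disjoint_union_left, disjoint_filter, disjoint_filter]
      exact ⟨fun l _ h1 => d02 _ h1, fun l _ h1 => d12 _ h1⟩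
    have h := card_union_of_disjoint hd2
    rw [card_union_of_disjoint hd1, ← hu, card_univ, Fintype.card_fin] at h
    omega
  have h0 := hcnt 0
  have h1 := hcnt 1
  have h2 := hcnt 2
  obtain ⟨p0, hp0⟩ := Nat.not_even_iff_odd.mp (hne 0)
  obtain ⟨p1, hp1⟩ := Nat.not_even_iff_odd.mp (hne 1)
  obtain ⟨p2, hp2⟩ := Nat.not_even_iff_odd.mp (hne 2)
  omega

/-- **covering**: every cell is an all-ones shift of a LOSING cell, so the total of all cell weights is at most the total of
the line sums through losing cells. -/
theorem cover_sum_le {m : ℕ} (E : (Fin m → ZMod 3) → ℝ) (hE : ∀ b, 0 ≤ E b) :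
    ∑ b : Fin m → ZMod 3, E b ≤ ∑ a ∈ evenCells m, ∑ γ : ZMod 3, E (fun l => a l - γ) := by
  choose g hg using fun b : Fin m → ZMod 3 => exists_shift_even b
  set ι : (Fin m → ZMod 3) → (Fin m → ZMod 3) × ZMod 3 := fun b => (fun l => b l + g b, g b) with hι
  set G : (Fin m → ZMod 3) × ZMod 3 → ℝ := fun p => E (fun l => p.1 l - p.2) with hGdef
  have hinj : Function.Injective ι := by
    intro b b' h
    simp only [hι, Prod.mk.injEq] at h
    obtain ⟨h1, h2⟩ := h
    funext l
    have := congrFun h1 l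
    rw [h2] at this
    exact add_right_cancel this
  have hG : ∀ b, E b = G (ι b) := by
    intro b
    simp only [hι, hGdef, add_sub_cancel_right]
  have himg : univ.image ι ⊆ evenCells m ×ˢ (univ : Finset (ZMod 3)) := by
    intro p hp
    rw [mem_image] at hp
    obtain ⟨b, _, rfl⟩ := hp
    rw [mem_product]
    refine ⟨?_, mem_univ _⟩
    unfold evenCells
    rw [mem_filter]
    exact ⟨mem_univ _, hg b⟩
  have hGnn : ∀ p, 0 ≤ G p := fun p => hE _
  calc ∑ b : Fin m → ZMod 3, E b = ∑ b : Fin m → ZMod 3, G (ι b) := sum_congr rfl (fun b _ => hG b)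
    _ = ∑ p ∈ univ.image ι, G p := (sum_image (fun b _ b' _ h => hinj h)).symm
    _ ≤ ∑ p ∈ evenCells m ×ˢ (univ : Finset (ZMod 3)), G p :=
        sum_le_sum_of_subset_of_nonneg himg (fun p _ _ => hGnn p)
    _ = ∑ a ∈ evenCells m, ∑ γ : ZMod 3, E (fun l => a l - γ) := by
        rw [sum_product]

/-- **line-to-cell estimate**: `Σ_γ #cell(a − γ·1) ≤ 3·#cell(a) + 3B` once every twist with `Σ α ≠ 0` is `≤ B` in norm. -/
theorem line_le_cell (M : Fin t → Fin N → ZMod 3) (v : Fin t → ZMod 3) {m : ℕ} (a : Fin m → ZMod 3) (k : Fin m → ℕ)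
    (B : ℝ) (hB0 : 0 ≤ B) (hB : ∀ α : Fin m → ZMod 3, (∑ l, α l) ≠ 0 → ‖fibSumM M v α a k‖ ≤ B) :
    (∑ γ : ZMod 3, (((fib M v).filter (fun x => ∀ l, kph x (k l) = a l - γ)).card : ℝ)) ≤
      3 * ((fib M v).filter (fun x => ∀ l, kph x (k l) = a l)).card + 3 * B := by
  have hc := cellM_count M v a k
  push_cast at hc
  have hl := line_identity M v a k
  set F : (Fin m → ZMod 3) → ℂ := fun α => fibSumM M v α a k with hF
  set Zc := (univ : Finset (Fin m → ZMod 3)).filter (fun α => ¬ (∑ l, α l = 0)) with hZc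
  have hsplit : ∑ α : Fin m → ZMod 3, F α =
      (∑ α ∈ (univ : Finset (Fin m → ZMod 3)).filter (fun α => ∑ l, α l = 0), F α) + ∑ α ∈ Zc, F α :=
    (sum_filter_add_sum_filter_not univ (fun α : Fin m → ZMod 3 => ∑ l, α l = 0) F).symm
  have hZc_card : (Zc.card : ℝ) ≤ 3 ^ m := by
    have h1 : Zc.card ≤ (univ : Finset (Fin m → ZMod 3)).card := card_filter_le _ _
    rw [card_univ, Fintype.card_fun, ZMod.card, Fintype.card_fin] at h1
    exact_mod_cast h1
  have hrest : ‖∑ α ∈ Zc, F α‖ ≤ 3 ^ m * B := by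
    refine (norm_sum_le _ _).trans ?_
    have hle : ∀ α ∈ Zc, ‖F α‖ ≤ B := by
      intro α hα
      rw [hZc, mem_filter] at hα
      exact hB α hα.2
    have := sum_le_sum hle
    rw [sum_const, nsmul_eq_mul] at this
    nlinarith [this, hZc_card]
  have e : (((3 ^ m * ∑ γ : ZMod 3, ((fib M v).filter (fun x => ∀ l, kph x (k l) = a l - γ)).card : ℕ)) : ℂ) =
      (((3 * (3 ^ m * ((fib M v).filter (fun x => ∀ l, kph x (k l) = a l)).card) : ℕ)) : ℂ) - 3 * ∑ α ∈ Zc, F α := by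
    push_cast
    rw [← hl, hc, hsplit]
    ring
  have hn : ‖(((3 ^ m * ∑ γ : ZMod 3, ((fib M v).filter (fun x => ∀ l, kph x (k l) = a l - γ)).card : ℕ)) : ℂ)‖ ≤
      ‖(((3 * (3 ^ m * ((fib M v).filter (fun x => ∀ l, kph x (k l) = a l)).card) : ℕ)) : ℂ)‖ +
        ‖(3 : ℂ) * ∑ α ∈ Zc, F α‖ := by
    rw [e]; exact norm_sub_le _ _
  rw [Complex.norm_natCast, Complex.norm_natCast] at hn
  push_cast at hn
  have h3 : ‖(3 : ℂ)‖ = 3 := by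
    have := Complex.norm_natCast 3
    push_cast at this
    exact this
  have hR : ‖(3 : ℂ) * ∑ α ∈ Zc, F α‖ ≤ 3 * (3 ^ m * B) := by
    rw [norm_mul, h3]; nlinarith [hrest]
  have h3m : (0 : ℝ) < 3 ^ m := by positivity
  have key : (3 : ℝ) ^ m * (∑ γ : ZMod 3, (((fib M v).filter (fun x => ∀ l, kph x (k l) = a l - γ)).card : ℝ)) ≤
      3 ^ m * (3 * ((fib M v).filter (fun x => ∀ l, kph x (k l) = a l)).card + 3 * B) := by
    nlinarith [hn, hR]
  exact le_of_mul_le_mul_left key h3m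

end Lines


end Summit.QuantumAdvantage.QuantumAdvantage.Theorems.SparsityDial
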